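import Summits.Ventures.PercRepro.C041BlockMapSubdiv

/-!
# ROW C-041 — THEOREM (PARALLEL EDGE): the block map of a host with an edge doubled is the block map of the host
plus the block map of the host with that edge contracted (p6, gen 34)

Setting of `C041BlockMapSubdiv`.  For a host `Z₁` and an edge `e₀` with ends `x = fst e₀`, `y = snd e₀`, the
DOUBLED host `dup Z₁ e₀` has a second copy `none` of `e₀` (edges `Option E₁`), and the CONTRACTED host
`contract Z₁ x y` identifies `y` with `x` by redirection (`redC`: every end `y` goes to `x`; `y` is then a stray
vertex, and the exits and the anchor are redirected too).  A colouring of the doubled host colours the two copies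
`b₁ = ω' (some e₀)`, `b₂ = ω' none`: if they agree the second copy changes nothing (`reflTransGen_dup_iff_agree`);
if they disagree `x` and `y` are joined in BOTH colours, which is exactly the contraction
(`reflTransGen_dup_iff_disagree`: a monochromatic path of the doubled host is a monochromatic path of the
contracted host between the redirected ends).  Summing over the colour of the copy: **`blockMap_dup`:
`blockMap (dup Z₁ e₀) u a₁ w = blockMap Z₁ u a₁ w + blockMap (contract Z₁ x y) (redC ∘ u) (redC a₁) w`**, i.e.
`Θ_{Z₁ + e′ ∥ e₀} = Θ_{Z₁} + Θ_{Z₁ / e₀}`.  COROLLARY (`inCone_blockMap_dup`): the cone conjecture for block maps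
is closed under doubling an edge — with THEOREM (SUBDIVISION), the reductions and THEOREM (WEDGE), CONJECTURE
(BLOCK MAP) for every host follows from the SIMPLE hosts (no loops, no parallel edges) that are 2-connected at
the anchor with every non-terminal vertex of degree `≥ 3`, and their contractions.
-/

namespace PercRepro

namespace ZoneZ

namespace MultiExit

open ZoneData Pendant Finset TwoExit TreeClosure

variable {V₁ E₁ U₁ U₂ : Type} (Z₁ : ZoneData V₁ E₁ U₁ U₂)

/-! ## The doubled host -/

variable (e₀ : E₁)

/-- The host with a second copy `none` of the edge `e₀`. -/
def dup : ZoneData V₁ (Option E₁) U₁ U₂ where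
  fst := fun e => match e with
    | some e => Z₁.fst e
    | none => Z₁.fst e₀
  snd := fun e => match e with
    | some e => Z₁.snd e
    | none => Z₁.snd e₀
  at₁ := Z₁.at₁
  at₂ := Z₁.at₂

/-- `Joins` of an old edge in the doubled host. -/
theorem dup_joins_some (e : E₁) (v v' : V₁) : (dup Z₁ e₀).Joins (some e) v v' ↔ Z₁.Joins e v v' := Iff.rfl

/-- `Joins` of the copy: the ends of `e₀`. -/
theorem dup_joins_none (v v' : V₁) : (dup Z₁ e₀).Joins none v v' ↔ Z₁.Joins e₀ v v' := Iff.rfl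

variable [DecidableEq V₁]

/-! ## The redirection and the contracted host -/

/-- The redirection of `y` to `x`: `y ↦ x`, every other vertex fixed. -/
def redC (x y v : V₁) : V₁ := if v = y then x else v

/-- The redirection of `y`. -/
theorem redC_self (x y : V₁) : redC x y y = x := by
  unfold redC
  rw [if_pos rfl]

/-- The redirection of a vertex other than `y`. -/
theorem redC_of_ne {x y v : V₁} (h : v ≠ y) : redC x y v = v := by
  unfold redC
  rw [if_neg h]

/-- The redirection of `x`. -/
theorem redC_fst (x y : V₁) : redC x y x = x := by
  by_cases h : x = y
  · rw [h, redC_self]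
  · exact redC_of_ne h

/-- Two vertices have the same redirection iff they are equal or both lie in `{x, y}`. -/
theorem redC_eq_redC_iff (x y v v' : V₁) :
    redC x y v = redC x y v' ↔ v = v' ∨ ((v = x ∨ v = y) ∧ (v' = x ∨ v' = y)) := by
  by_cases hv : v = y <;> by_cases hv' : v' = y
  · subst hv hv'
    simp
  · rw [hv, redC_self, redC_of_ne hv']
    constructor
    · intro h
      exact Or.inr ⟨Or.inr rfl, Or.inl h.symm⟩
    · rintro (h | ⟨-, h | h⟩)
      · exact absurd h.symm hv'
      · exact h.symm
      · exact absurd h hv'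
  · rw [hv', redC_self, redC_of_ne hv]
    constructor
    · intro h
      exact Or.inr ⟨Or.inl h, Or.inr rfl⟩
    · rintro (h | ⟨h | h, -⟩)
      · exact absurd h hv
      · exact h
      · exact absurd h hv
  · rw [redC_of_ne hv, redC_of_ne hv']
    constructor
    · intro h
      exact Or.inl h
    · rintro (h | ⟨h | h, h' | h'⟩)
      · exact h
      · exact h.trans h'.symm
      · exact absurd h' hv'
      · exact absurd h hv
      · exact absurd h hv

/-- The host with `y` identified with `x`: every end `y` redirected to `x`. -/
def contract (x y : V₁) : ZoneData V₁ E₁ U₁ U₂ where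
  fst := fun e => redC x y (Z₁.fst e)
  snd := fun e => redC x y (Z₁.snd e)
  at₁ := fun t => redC x y (Z₁.at₁ t)
  at₂ := fun t => redC x y (Z₁.at₂ t)

/-- `Joins` in the contracted host: the redirected ends. -/
theorem contract_joins (x y : V₁) (e : E₁) (v v' : V₁) :
    (contract Z₁ x y).Joins e v v' ↔ ∃ v₁ v₂, v = redC x y v₁ ∧ v' = redC x y v₂ ∧ Z₁.Joins e v₁ v₂ := by
  unfold Joins
  show (redC x y (Z₁.fst e) = v ∧ redC x y (Z₁.snd e) = v') ∨
    (redC x y (Z₁.fst e) = v' ∧ redC x y (Z₁.snd e) = v) ↔ _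
  constructor
  · rintro (⟨h1, h2⟩ | ⟨h1, h2⟩)
    · exact ⟨_, _, h1.symm, h2.symm, Or.inl ⟨rfl, rfl⟩⟩
    · exact ⟨_, _, h2.symm, h1.symm, Or.inr ⟨rfl, rfl⟩⟩
  · rintro ⟨v₁, v₂, rfl, rfl, (⟨rfl, rfl⟩ | ⟨rfl, rfl⟩)⟩
    · exact Or.inl ⟨rfl, rfl⟩
    · exact Or.inr ⟨rfl, rfl⟩

/-- The ends of `e₀` have the same redirection. -/
theorem redC_eq_of_joins_self {v v' : V₁} (h : Z₁.Joins e₀ v v') :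
    redC (Z₁.fst e₀) (Z₁.snd e₀) v = redC (Z₁.fst e₀) (Z₁.snd e₀) v' := by
  rcases h with ⟨rfl, rfl⟩ | ⟨rfl, rfl⟩
  · rw [redC_fst, redC_self]
  · rw [redC_fst, redC_self]

section Reach

variable (c : Bool) (ω' : Option E₁ → Bool)

omit [DecidableEq V₁] in
/-- The two copies AGREE in colour: paths of the doubled host are paths of `Z₁`. -/
theorem reflTransGen_dup_iff_agree (h : ω' (some e₀) = ω' none) (v v' : V₁) :
    Relation.ReflTransGen (cAdj (dup Z₁ e₀) c ω') v v' ↔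
      Relation.ReflTransGen (cAdj Z₁ c fun e => ω' (some e)) v v' := by
  constructor
  · intro hp
    induction hp with
    | refl => exact Relation.ReflTransGen.refl
    | tail _ hstep ih =>
      obtain ⟨e, hj, hc⟩ := hstep
      rcases e with _ | e
      · exact ih.tail ⟨e₀, (dup_joins_none Z₁ e₀ _ _).1 hj, h.trans hc⟩
      · exact ih.tail ⟨e, (dup_joins_some Z₁ e₀ e _ _).1 hj, hc⟩
  · intro hp
    induction hp with
    | refl => exact Relation.ReflTransGen.refl
    | tail _ hstep ih =>
      obtain ⟨e, hj, hc⟩ := hstep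
      exact ih.tail ⟨some e, (dup_joins_some Z₁ e₀ e _ _).2 hj, hc⟩

omit [DecidableEq V₁] in
/-- The two copies DISAGREE in colour: the ends of `e₀` are adjacent in either colour. -/
theorem cAdj_dup_ends_of_disagree (h : ω' (some e₀) ≠ ω' none) :
    cAdj (dup Z₁ e₀) c ω' (Z₁.fst e₀) (Z₁.snd e₀) := by
  by_cases hc : ω' (some e₀) = c
  · exact ⟨some e₀, (dup_joins_some Z₁ e₀ e₀ _ _).2 (Or.inl ⟨rfl, rfl⟩), hc⟩
  · have h1 : ω' (some e₀) = !c := Bool.eq_not_iff.2 hc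
    have h2 : ω' none = !(ω' (some e₀)) := Bool.eq_not_iff.2 (Ne.symm h)
    refine ⟨none, (dup_joins_none Z₁ e₀ _ _).2 (Or.inl ⟨rfl, rfl⟩), ?_⟩
    rw [h2, h1, Bool.not_not]

/-- The two copies disagree: vertices with the same redirection are connected in either colour. -/
theorem reflTransGen_dup_of_redC_eq (h : ω' (some e₀) ≠ ω' none) {v v' : V₁}
    (hvv : redC (Z₁.fst e₀) (Z₁.snd e₀) v = redC (Z₁.fst e₀) (Z₁.snd e₀) v') :
    Relation.ReflTransGen (cAdj (dup Z₁ e₀) c ω') v v' := by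
  have hxy := cAdj_dup_ends_of_disagree Z₁ e₀ c ω' h
  have hyx := cAdj_symm _ c ω' _ _ hxy
  rcases (redC_eq_redC_iff _ _ v v').1 hvv with rfl | ⟨hv | hv, hv' | hv'⟩
  · exact Relation.ReflTransGen.refl
  · rw [hv, hv']
  · rw [hv, hv']
    exact Relation.ReflTransGen.single hxy
  · rw [hv, hv']
    exact Relation.ReflTransGen.single hyx
  · rw [hv, hv']

/-- The two copies DISAGREE in colour: paths of the doubled host are paths of the contracted host between the
redirected ends. -/
theorem reflTransGen_dup_iff_disagree (h : ω' (some e₀) ≠ ω' none) (v v' : V₁) :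
    Relation.ReflTransGen (cAdj (dup Z₁ e₀) c ω') v v' ↔
      Relation.ReflTransGen (cAdj (contract Z₁ (Z₁.fst e₀) (Z₁.snd e₀)) c fun e => ω' (some e))
        (redC (Z₁.fst e₀) (Z₁.snd e₀) v) (redC (Z₁.fst e₀) (Z₁.snd e₀) v') := by
  constructor
  · intro hp
    induction hp with
    | refl => exact Relation.ReflTransGen.refl
    | tail _ hstep ih =>
      obtain ⟨e, hj, hc⟩ := hstep
      rcases e with _ | e
      · rw [dup_joins_none] at hj
        rw [← redC_eq_of_joins_self Z₁ e₀ hj]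
        exact ih
      · rw [dup_joins_some] at hj
        exact ih.tail ⟨e, (contract_joins Z₁ _ _ e _ _).2 ⟨_, _, rfl, rfl, hj⟩, hc⟩
  · intro hp
    -- every vertex with the redirection of the target is reached
    have key : ∀ z, Relation.ReflTransGen (cAdj (contract Z₁ (Z₁.fst e₀) (Z₁.snd e₀)) c fun e => ω' (some e))
        (redC (Z₁.fst e₀) (Z₁.snd e₀) v) z →
        ∀ v'', redC (Z₁.fst e₀) (Z₁.snd e₀) v'' = z → Relation.ReflTransGen (cAdj (dup Z₁ e₀) c ω') v v'' := by
      intro z hz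
      induction hz with
      | refl =>
        intro v'' hv''
        exact reflTransGen_dup_of_redC_eq Z₁ e₀ c ω' h hv''.symm
      | tail _ hstep ih =>
        intro v'' hv''
        obtain ⟨e, hj, hc⟩ := hstep
        rw [contract_joins] at hj
        obtain ⟨v₁, v₂, hz, hz', hvv⟩ := hj
        exact ((ih v₁ hz.symm).tail ⟨some e, (dup_joins_some Z₁ e₀ e _ _).2 hvv, hc⟩).trans
          (reflTransGen_dup_of_redC_eq Z₁ e₀ c ω' h (hz'.symm.trans hv''.symm))
    exact key _ hp v' rfl

end Reach

/-! ## The statuses, the sets and the colouring terms -/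

section Statuses

variable (ω' : Option E₁ → Bool)

omit [DecidableEq V₁] in
/-- Merged status, copies agreeing. -/
theorem Mg_dup_agree (h : ω' (some e₀) = ω' none) (v v' : V₁) :
    (dup Z₁ e₀).Mg v v' ω' ↔ Z₁.Mg v v' fun e => ω' (some e) := by
  rw [Mg_iff_reflTransGen, Mg_iff_reflTransGen]
  exact reflTransGen_dup_iff_agree Z₁ e₀ false ω' h v v'

omit [DecidableEq V₁] in
/-- Reached status, copies agreeing. -/
theorem Rd_dup_agree (h : ω' (some e₀) = ω' none) (v v' : V₁) :
    (dup Z₁ e₀).Rd v v' ω' ↔ Z₁.Rd v v' fun e => ω' (some e) := by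
  rw [Rd_iff_reflTransGen, Rd_iff_reflTransGen]
  exact reflTransGen_dup_iff_agree Z₁ e₀ true ω' h v v'

/-- Merged status, copies disagreeing. -/
theorem Mg_dup_disagree (h : ω' (some e₀) ≠ ω' none) (v v' : V₁) :
    (dup Z₁ e₀).Mg v v' ω' ↔ (contract Z₁ (Z₁.fst e₀) (Z₁.snd e₀)).Mg (redC (Z₁.fst e₀) (Z₁.snd e₀) v)
      (redC (Z₁.fst e₀) (Z₁.snd e₀) v') fun e => ω' (some e) := by
  rw [Mg_iff_reflTransGen, Mg_iff_reflTransGen]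
  exact reflTransGen_dup_iff_disagree Z₁ e₀ false ω' h v v'

/-- Reached status, copies disagreeing. -/
theorem Rd_dup_disagree (h : ω' (some e₀) ≠ ω' none) (v v' : V₁) :
    (dup Z₁ e₀).Rd v v' ω' ↔ (contract Z₁ (Z₁.fst e₀) (Z₁.snd e₀)).Rd (redC (Z₁.fst e₀) (Z₁.snd e₀) v)
      (redC (Z₁.fst e₀) (Z₁.snd e₀) v') fun e => ω' (some e) := by
  rw [Rd_iff_reflTransGen, Rd_iff_reflTransGen]
  exact reflTransGen_dup_iff_disagree Z₁ e₀ true ω' h v v'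

variable {ι : Type} (u : ι → V₁) (a₁ : V₁) [Fintype ι]

omit [DecidableEq V₁] in
/-- The merged set, copies agreeing. -/
theorem merged_dup_agree (h : ω' (some e₀) = ω' none) :
    merged (dup Z₁ e₀) u a₁ ω' = merged Z₁ u a₁ fun e => ω' (some e) := by
  ext k
  rw [mem_merged, mem_merged, Mg_dup_agree Z₁ e₀ ω' h]

omit [DecidableEq V₁] in
/-- The blocks, copies agreeing. -/
theorem blk_dup_agree (h : ω' (some e₀) = ω' none) :
    blk (dup Z₁ e₀) u a₁ ω' = blk Z₁ u a₁ fun e => ω' (some e) := by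
  funext k
  ext l
  rw [mem_blk, mem_blk, Mg_dup_agree Z₁ e₀ ω' h, Mg_dup_agree Z₁ e₀ ω' h]

omit [DecidableEq V₁] in
/-- The blocks, copies agreeing. -/
theorem blocks_dup_agree (h : ω' (some e₀) = ω' none) :
    blocks (dup Z₁ e₀) u a₁ ω' = blocks Z₁ u a₁ fun e => ω' (some e) := by
  ext B
  rw [mem_blocks, mem_blocks]
  simp only [Mg_dup_agree Z₁ e₀ ω' h, blk_dup_agree Z₁ e₀ ω' u a₁ h]

/-- The merged set, copies disagreeing: that of the contracted host at the redirected exits. -/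
theorem merged_dup_disagree (h : ω' (some e₀) ≠ ω' none) :
    merged (dup Z₁ e₀) u a₁ ω' = merged (contract Z₁ (Z₁.fst e₀) (Z₁.snd e₀))
      (fun k => redC (Z₁.fst e₀) (Z₁.snd e₀) (u k)) (redC (Z₁.fst e₀) (Z₁.snd e₀) a₁) fun e => ω' (some e) := by
  ext k
  rw [mem_merged, mem_merged, Mg_dup_disagree Z₁ e₀ ω' h]

/-- The blocks, copies disagreeing. -/
theorem blk_dup_disagree (h : ω' (some e₀) ≠ ω' none) :
    blk (dup Z₁ e₀) u a₁ ω' = blk (contract Z₁ (Z₁.fst e₀) (Z₁.snd e₀))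
      (fun k => redC (Z₁.fst e₀) (Z₁.snd e₀) (u k)) (redC (Z₁.fst e₀) (Z₁.snd e₀) a₁) fun e => ω' (some e) := by
  funext k
  ext l
  rw [mem_blk, mem_blk, Mg_dup_disagree Z₁ e₀ ω' h, Mg_dup_disagree Z₁ e₀ ω' h]

/-- The blocks, copies disagreeing. -/
theorem blocks_dup_disagree (h : ω' (some e₀) ≠ ω' none) :
    blocks (dup Z₁ e₀) u a₁ ω' = blocks (contract Z₁ (Z₁.fst e₀) (Z₁.snd e₀))
      (fun k => redC (Z₁.fst e₀) (Z₁.snd e₀) (u k)) (redC (Z₁.fst e₀) (Z₁.snd e₀) a₁) fun e => ω' (some e) := by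
  ext B
  rw [mem_blocks, mem_blocks]
  simp only [Mg_dup_disagree Z₁ e₀ ω' h, blk_dup_disagree Z₁ e₀ ω' u a₁ h]

omit [DecidableEq V₁] in
/-- The colouring term, copies agreeing. -/
theorem colTerm_dup_agree (h : ω' (some e₀) = ω' none) (w : ι → Vec6) :
    colTerm (dup Z₁ e₀) u a₁ ω' w = colTerm Z₁ u a₁ (fun e => ω' (some e)) w := by
  unfold colTerm
  rw [merged_dup_agree Z₁ e₀ ω' u a₁ h, blocks_dup_agree Z₁ e₀ ω' u a₁ h]
  simp only [Rd_dup_agree Z₁ e₀ ω' h]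

/-- The colouring term, copies disagreeing: that of the contracted host. -/
theorem colTerm_dup_disagree (h : ω' (some e₀) ≠ ω' none) (w : ι → Vec6) :
    colTerm (dup Z₁ e₀) u a₁ ω' w = colTerm (contract Z₁ (Z₁.fst e₀) (Z₁.snd e₀))
      (fun k => redC (Z₁.fst e₀) (Z₁.snd e₀) (u k)) (redC (Z₁.fst e₀) (Z₁.snd e₀) a₁) (fun e => ω' (some e)) w := by
  unfold colTerm
  rw [merged_dup_disagree Z₁ e₀ ω' u a₁ h, blocks_dup_disagree Z₁ e₀ ω' u a₁ h]
  simp only [Rd_dup_disagree Z₁ e₀ ω' h]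

end Statuses

/-! ## THEOREM (PARALLEL EDGE) -/

section Main

variable {ι : Type} (u : ι → V₁) (a₁ : V₁) [Fintype ι]

/-- Summing the colouring terms over the colour of the copy: the term of `Z₁` plus the term of the contracted
host. -/
theorem sum_bool_colTerm_dup (ω : E₁ → Bool) (w : ι → Vec6) :
    ∑ b : Bool, colTerm (dup Z₁ e₀) u a₁ (extCol ω b) w =
      colTerm Z₁ u a₁ ω w + colTerm (contract Z₁ (Z₁.fst e₀) (Z₁.snd e₀))
        (fun k => redC (Z₁.fst e₀) (Z₁.snd e₀) (u k)) (redC (Z₁.fst e₀) (Z₁.snd e₀) a₁) ω w := by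
  rw [Fintype.sum_bool]
  cases hb : ω e₀
  · rw [colTerm_dup_disagree Z₁ e₀ _ u a₁ (by simpa [extCol] using hb) w,
      colTerm_dup_agree Z₁ e₀ _ u a₁ (by simpa [extCol] using hb) w, add_comm]
    rfl
  · rw [colTerm_dup_agree Z₁ e₀ _ u a₁ (by simpa [extCol] using hb) w,
      colTerm_dup_disagree Z₁ e₀ _ u a₁ (by simpa [extCol] using hb) w]
    rfl

variable [Fintype E₁] [DecidableEq E₁]

/-- **THEOREM (PARALLEL EDGE)**: the block map of the host with `e₀` doubled is the block map of the host plus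
the block map of the host with `e₀` contracted (exits and anchor redirected). -/
theorem blockMap_dup (w : ι → Vec6) :
    blockMap (dup Z₁ e₀) u a₁ w = blockMap Z₁ u a₁ w + blockMap (contract Z₁ (Z₁.fst e₀) (Z₁.snd e₀))
      (fun k => redC (Z₁.fst e₀) (Z₁.snd e₀) (u k)) (redC (Z₁.fst e₀) (Z₁.snd e₀) a₁) w := by
  rw [blockMap_eq_sum_colTerm, blockMap_eq_sum_colTerm, blockMap_eq_sum_colTerm, ← Finset.sum_add_distrib,
    ← Fintype.sum_equiv (extColEquiv (E₁ := E₁)) (fun p => colTerm (dup Z₁ e₀) u a₁ (extColEquiv p) w) _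
      (fun _ => rfl),
    Fintype.sum_prod_type]
  exact Finset.sum_congr rfl fun ω _ => sum_bool_colTerm_dup Z₁ e₀ u a₁ ω w

/-- **The cone conjecture for block maps is closed under doubling an edge**: if the block maps of the host and
of the contracted host send the family into the cone, so does the block map of the doubled host. -/
theorem inCone_blockMap_dup (w : ι → Vec6) (h₁ : InCone (blockMap Z₁ u a₁ w))
    (h₂ : InCone (blockMap (contract Z₁ (Z₁.fst e₀) (Z₁.snd e₀))
      (fun k => redC (Z₁.fst e₀) (Z₁.snd e₀) (u k)) (redC (Z₁.fst e₀) (Z₁.snd e₀) a₁) w)) :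
    InCone (blockMap (dup Z₁ e₀) u a₁ w) := by
  rw [blockMap_dup]
  exact h₁.add h₂

end Main

end MultiExit

end ZoneZ

end PercRepro
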